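import Summits.QuantumFields.QCD.Theses.GaussianLinkFrames
import Summits.QuantumFields.QCD.Theorems.GaussianLinkFramesFrameAPrioriBoundLineDefs
import Literature.MathematicalPhysics.QuantumLattice.GrassmannIntegralProofs

/-!
# Negative lemma for the crux `FrameAPrioriBound` (stmt-QuantumFields-17374): the slab flat band —
# a REALISED dark fibre of the `Q₂` pencil at `(m₀, z) = (-1, ±1)`

Route `GaussianLinkFrames` (QCD), crux `FrameAPrioriBound`, picked line `cube-cofactor`, open stub
`CubeCofactor.stub_cubeMeanSquareDomination` ("(MS)": `E_W Σ|adj(H(refit W) − z)_{xy}|² ≤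
C₂ · E_W |det(H(refit W) − z)|²` uniformly, real `z` with `|z| ≤ 1` included).
Refuter file (cdisprove seat, cycle 1): sorry-free, no definitions, no positive route-item conclusion.
Certified copy of §E of `Summits/QuantumFields/QCD/Cruxes/FrameAPrioriBound/Disproof.lean`.

**Content.**  `H = γ₅ D_W(U; m₀, r = 1)` in the tree's conventions (`wilsonDirac`, `spinorLift gammaFive`,
`fundamentalRep (Fin 3)`; line vocabulary `hz`, `refit`, `touches`, `haarPi` of the landed LineDefs).
On the torus of side `7`, centre `x = y = 0`, the two layers `{v₃ = 3}` (inner) and `{v₃ = 4}` (outer)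
lie outside the cube `Q₂(0) = {v : v_μ ∈ {-2,…,2}}`, every link with both endpoints in them is untouched
by the fibre (`touches 0 0 = false`), and at `m₀ = -1` the state
`ψ_E(v,a,α) = δ_{a0} · [v₃ = 3] s₊(α) + δ_{a0} · [v₃ = 4] (−E γ₅ s₊)(α)`, `s₊ = (1,0,1,0)` (`γ₃ s₊ = s₊`),
constant in the transverse directions, satisfies `(γ₅ D_W(R; -1, 1) − E) ψ_E = 0` for `E = ±1` and for
EVERY gauge field `R` whose slab links are trivial — in particular for `R = refit (touches 0 0) U W` with
ANY fibre configuration `W` when the background `U` has trivial slab links (e.g. `U ≡ 1`):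

* `wilsonDirac_mulVec_apply` — row formula for `D_W ψ` (general `L, N, G, ρ, m, r`);
* `wilsonDirac_mulVec_slab` — `D_W(R; -1, 1) ψ_E = φ_E` (the on-site `3` is cancelled by the three transverse
  Wilson hops; the `±3̂` hops act inside the slab; the PORT rows `v₃ = 2` and `v₃ = 5 ≡ -2` vanish because
  `(1 − γ₃) s₊ = 0` and `(1 + γ₃) γ₅ s₊ = 0`, whatever `SU(3)` matrix the re-sampled port link carries);
* `hz_mulVec_slab`, `det_hz_eq_zero_of_slabTrivial` — `(H − E) ψ_E = 0`, `ψ_E ≠ 0`, `det (H − E) = 0`;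
* `touches_zero_eq_false`, `det_hz_refit_eq_zero` — the fibre over a trivial-slab background is DARK:
  `det (hz (refit (touches 0 0) U W) (-1) E) = 0` for all `W`, `E = ±1`;
* `ms_rhs_eq_zero` — hence the right-hand side of (MS) vanishes at `(L, m₀, z, x, y, U) = (7, -1, ±1, 0, 0, 1)`.

**What this says about the line.**  (MS) is not violated here — the two chiralities × three colours give
corank `≥ 6`, so the adjugate vanishes identically on these fibres and (MS) reads `0 ≤ 0` — but the
edge case `det ≡ 0 on the fibre` of the stub's docstring is REALISED inside the parameter window
(`m₀ = -1 ∈ [-2,2]`, `|z| = 1`), by a mechanism (codimension-1 wrapping slab of thickness 2 with chiral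
boundary data) that exists for every `L ≥ 7`, every direction and both signs, adjacent to the cube face;
moreover `z = ±1` is simultaneously the band edge `|E| = 1` of the `W`-independent free exterior continuum at
`m₀ = -1` (`E² − 1 = (Σ_μ d_μ)² − Σ_μ d_μ² ≥ 0`, `d_μ = 1 − cos p_μ`), i.e. the non-isolated case left
untreated in the lead's order-comparison analysis.  Any proof of (MS) by "`det ≢ 0` on fibres + compactness"
must therefore handle dark fibres and their neighbourhoods explicitly.
References: Wilson 1975; Montvay–Münster 1994 §4.2 (Wilson fermions, `γ₅`-hermiticity).
-/

noncomputable section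

namespace Summit.QuantumFields.QCD.Theorems.FrameAPrioriBound.Negative

open scoped BigOperators Matrix
open MeasureTheory Literature.MathematicalPhysics.QuantumFieldTheory
  Literature.MathematicalPhysics.QuantumLattice Literature.Probability.LatticeModels
open Summit.QuantumFields.QCD.Cruxes.FrameAPrioriBound.CubeCofactor

/-! ## Row formulas -/

section RowFormula

variable {L N : ℕ} [NeZero L] {G : Type*} [Group G]

/-- Row formula: `(D_W ψ)(x,a,α) = (m+4r) ψ(x,a,α) − ½ Σ_μ Σ_{b,β} [ (r−γ_μ)_{αβ} ρ(U(x,μ))_{ab}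
ψ(x+μ̂,b,β) + (r+γ_μ)_{αβ} ρ(U(x−μ̂,μ)⁻¹)_{ab} ψ(x−μ̂,b,β) ]` (Montvay–Münster (4.85)). [folklore] -/
theorem wilsonDirac_mulVec_apply (ρ : G →* Matrix (Fin N) (Fin N) ℂ) (U : GaugeConfig 4 L G)
    (m r : ℝ) (ψ : TorusSite 4 L × Fin N × Fin 4 → ℂ) (p : TorusSite 4 L × Fin N × Fin 4) :
    (wilsonDirac ρ U m r *ᵥ ψ) p =
      ((m + 4 * r : ℝ) : ℂ) * ψ p -
        (1 / 2 : ℂ) * ∑ μ : Fin 4, ∑ b : Fin N, ∑ β : Fin 4,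
          ((((r : ℂ) • (1 : Matrix (Fin 4) (Fin 4) ℂ) - euclideanGamma μ) p.2.2 β *
              ρ (U (p.1, μ)) p.2.1 b) *
              ψ (Literature.MathematicalPhysics.QuantumFieldTheory.Site.shift p.1 μ, b, β) +
           (((r : ℂ) • (1 : Matrix (Fin 4) (Fin 4) ℂ) + euclideanGamma μ) p.2.2 β *
              ρ (U (p.1 - Pi.single μ 1, μ))⁻¹ p.2.1 b) * ψ (p.1 - Pi.single μ 1, b, β)) := by
  have hshift : ∀ (y : TorusSite 4 L) (μ : Fin 4),
      (p.1 = Literature.MathematicalPhysics.QuantumFieldTheory.Site.shift y μ) ↔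
        (y = p.1 - Pi.single μ 1) := by
    intro y μ
    rw [Literature.MathematicalPhysics.QuantumFieldTheory.Site.shift, eq_sub_iff_add_eq]
    exact eq_comm
  simp only [Matrix.mulVec, dotProduct, wilsonDirac, Matrix.of_apply]
  simp only [sub_mul, Finset.sum_sub_distrib, ite_mul, zero_mul, Finset.sum_ite_eq,
    Finset.mem_univ, if_true]
  congr 1
  simp only [mul_assoc, ← Finset.mul_sum]
  congr 1
  simp only [Finset.sum_mul, add_mul]
  rw [Finset.sum_comm]
  refine Finset.sum_congr rfl fun μ _ => ?_
  simp only [Finset.sum_add_distrib, Fintype.sum_prod_type, ite_mul, zero_mul]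
  simp only [hshift, Finset.sum_ite_irrel, Finset.sum_const_zero, Finset.sum_ite_eq',
    Finset.mem_univ, if_true, mul_assoc]

/-- Row formula for the spinor lift: `((1 ⊗ 1 ⊗ Γ) f)(x,a,α) = Σ_β Γ_{αβ} f(x,a,β)`. [folklore] -/
theorem spinorLift_mulVec_apply (Γ : Matrix (Fin 4) (Fin 4) ℂ)
    (f : TorusSite 4 L × Fin N × Fin 4 → ℂ) (p : TorusSite 4 L × Fin N × Fin 4) :
    (spinorLift Γ *ᵥ f) p = ∑ β, Γ p.2.2 β * f (p.1, p.2.1, β) := by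
  obtain ⟨x, a, α⟩ := p
  simp only [spinorLift, Matrix.mulVec, dotProduct, Fintype.sum_prod_type,
    Matrix.kroneckerMap_apply, Matrix.one_apply, ite_mul, one_mul, zero_mul, Finset.sum_ite_irrel,
    Finset.sum_const_zero, Finset.sum_ite_eq, Finset.mem_univ, if_true]

end RowFormula

/-! ## The slab state on the torus of side `7` -/

section Slab

/-! The slab state `ψ_E` (colour `0`; spinor `s₊ = (1,0,1,0)` on the inner layer `v₃ = 3`,
`−E γ₅ s₊ = (−E,0,E,0)` on the outer layer `v₃ = 4`, zero elsewhere) and its image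
`φ_E = D_W(R; -1, 1) ψ_E` (`E γ₅ s₊ = (E,0,−E,0)` on layer 3, `−s₊` on layer 4) enter the lemmas below
through binders `ψ φ` with their defining equations `hψ hφ` (no definitions, no notation). -/

/-- Coordinates of a shifted site. [folklore] -/
theorem shift_apply (v : TorusSite 4 7) (μ ν : Fin 4) :
    (Literature.MathematicalPhysics.QuantumFieldTheory.Site.shift v μ) ν = v ν + if ν = μ then 1 else 0 := by
  simp [Literature.MathematicalPhysics.QuantumFieldTheory.Site.shift, Pi.single_apply]

/-- Coordinates of a back-shifted site. [folklore] -/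
theorem sub_single_apply (v : TorusSite 4 7) (μ ν : Fin 4) :
    (v - Pi.single μ 1 : TorusSite 4 7) ν = v ν - if ν = μ then 1 else 0 := by
  simp [Pi.single_apply]

/-- Exhaustion of `ZMod 7`. [folklore] -/
theorem zmod7_cases (c : ZMod 7) : c = 0 ∨ c = 1 ∨ c = 2 ∨ c = 3 ∨ c = 4 ∨ c = 5 ∨ c = 6 := by
  revert c; decide

set_option maxHeartbeats 4000000 in
/-- **`D_W(R; -1, 1) ψ_E = φ_E`** for every gauge field `R` on the torus of side `7` whose links with
both endpoints in the slab `{v₃ ∈ {3,4}}` are trivial (`hT`: transverse links of the two layers,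
`hF`: the `3̂`-links from layer 3 to layer 4).  Row by row: on the slab the on-site `3 ψ` is cancelled
by the three transverse hops and the `±3̂` hop produces `φ`; the port rows `v₃ = 2`, `v₃ = 5` vanish
by `(1 − γ₃) s₊ = 0`, `(1 + γ₃)(−Eγ₅ s₊) = 0` for ANY port link matrix; all other rows see `ψ = 0`.
[folklore] -/
theorem wilsonDirac_mulVec_slab (R : GaugeConfig 4 7 (Matrix.specialUnitaryGroup (Fin 3) ℂ))
    (hT : ∀ (v : TorusSite 4 7) (μ : Fin 4), μ ≠ 3 → (v 3 = 3 ∨ v 3 = 4) → R (v, μ) = 1)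
    (hF : ∀ v : TorusSite 4 7, v 3 = 3 → R (v, 3) = 1) (E : ℂ)
    (ψ φ : TorusSite 4 7 × Fin 3 × Fin 4 → ℂ)
    (hψ : ψ = fun p => if p.2.1 = 0 then
      (if p.1 3 = 3 then (![1, 0, 1, 0] : Fin 4 → ℂ) p.2.2
        else if p.1 3 = 4 then (![-E, 0, E, 0] : Fin 4 → ℂ) p.2.2 else 0) else 0)
    (hφ : φ = fun p => if p.2.1 = 0 then
      (if p.1 3 = 3 then (![E, 0, -E, 0] : Fin 4 → ℂ) p.2.2
        else if p.1 3 = 4 then (![-1, 0, -1, 0] : Fin 4 → ℂ) p.2.2 else 0) else 0) :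
    wilsonDirac (fundamentalRep (Fin 3)) R (-1) 1 *ᵥ ψ = φ := by
  subst hψ hφ
  ext ⟨v, a, α⟩
  rw [wilsonDirac_mulVec_apply]
  -- the slab link facts, in the coerced form in which `simp` meets them
  have hT₁ : ∀ μ : Fin 4, μ ≠ 3 → (v 3 = 3 ∨ v 3 = 4) →
      ((R (v, μ) : Matrix.specialUnitaryGroup (Fin 3) ℂ) : Matrix (Fin 3) (Fin 3) ℂ) = 1 :=
    fun μ hμ hv => by rw [hT v μ hμ hv]; rfl
  have hT₂ : ∀ μ : Fin 4, μ ≠ 3 → (v 3 = 3 ∨ v 3 = 4) →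
      (((R (v - Pi.single μ 1, μ))⁻¹ : Matrix.specialUnitaryGroup (Fin 3) ℂ) :
        Matrix (Fin 3) (Fin 3) ℂ) = 1 := by
    intro μ hμ hv
    have h3 : (v - Pi.single μ 1 : TorusSite 4 7) 3 = v 3 := by
      rw [sub_single_apply, if_neg (fun h : (3 : Fin 4) = μ => hμ h.symm), sub_zero]
    rw [hT (v - Pi.single μ 1) μ hμ (by rw [h3]; exact hv), inv_one]; rfl
  have hF₁ : v 3 = 3 →
      ((R (v, 3) : Matrix.specialUnitaryGroup (Fin 3) ℂ) : Matrix (Fin 3) (Fin 3) ℂ) = 1 :=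
    fun hv => by rw [hF v hv]; rfl
  have hF₂ : v 3 = 4 →
      (((R (v - Pi.single 3 1, 3))⁻¹ : Matrix.specialUnitaryGroup (Fin 3) ℂ) :
        Matrix (Fin 3) (Fin 3) ℂ) = 1 := by
    intro hv
    have h3 : (v - Pi.single 3 1 : TorusSite 4 7) 3 = 3 := by
      rw [sub_single_apply, if_pos rfl, hv]; decide
    rw [hF (v - Pi.single 3 1) h3, inv_one]; rfl
  rcases zmod7_cases (v 3) with hc | hc | hc | hc | hc | hc | hc <;>
  fin_cases a <;> fin_cases α <;>
  simp (config := {decide := true}) [hc, shift_apply, Fin.sum_univ_four, Fin.sum_univ_three,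
    Matrix.one_apply, euclideanGamma_zero, euclideanGamma_one, euclideanGamma_two,
    euclideanGamma_three, hT₁, hT₂, hF₁, hF₂] <;>
  ring

set_option maxHeartbeats 4000000 in
/-- **The slab state is a `W`-robust eigenvector**: `(γ₅ D_W(R; -1, 1) − E) ψ_E = 0` for `E = ±1`
and every trivial-slab field `R` (`γ₅ φ_E = E ψ_E` needs `E² = 1` on the outer layer). [folklore] -/
theorem hz_mulVec_slab (R : GaugeConfig 4 7 (Matrix.specialUnitaryGroup (Fin 3) ℂ))
    (hT : ∀ (v : TorusSite 4 7) (μ : Fin 4), μ ≠ 3 → (v 3 = 3 ∨ v 3 = 4) → R (v, μ) = 1)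
    (hF : ∀ v : TorusSite 4 7, v 3 = 3 → R (v, 3) = 1) (E : ℂ) (hE : E = 1 ∨ E = -1)
    (ψ : TorusSite 4 7 × Fin 3 × Fin 4 → ℂ)
    (hψ : ψ = fun p => if p.2.1 = 0 then
      (if p.1 3 = 3 then (![1, 0, 1, 0] : Fin 4 → ℂ) p.2.2
        else if p.1 3 = 4 then (![-E, 0, E, 0] : Fin 4 → ℂ) p.2.2 else 0) else 0) :
    hz R (-1) E *ᵥ ψ = 0 := by
  have hD := wilsonDirac_mulVec_slab R hT hF E ψ _ hψ rfl
  subst hψ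
  dsimp only [hz]
  rw [Matrix.sub_mulVec, ← Matrix.mulVec_mulVec, hD, Matrix.smul_mulVec, Matrix.one_mulVec]
  ext ⟨v, a, α⟩
  rw [Pi.sub_apply, spinorLift_mulVec_apply, Pi.smul_apply, Pi.zero_apply]
  rcases hE with rfl | rfl <;>
  rcases zmod7_cases (v 3) with hc | hc | hc | hc | hc | hc | hc <;>
  fin_cases a <;> fin_cases α <;>
  simp (config := {decide := true}) [hc, gammaFive_eq_diagonal, Matrix.diagonal_apply]

/-- The slab state is non-zero: its value at the site `(0,0,0,3)`, colour `0`, spin `0` is `1`.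
[folklore] -/
theorem slab_ne_zero (E : ℂ) (ψ : TorusSite 4 7 × Fin 3 × Fin 4 → ℂ)
    (hψ : ψ = fun p => if p.2.1 = 0 then
      (if p.1 3 = 3 then (![1, 0, 1, 0] : Fin 4 → ℂ) p.2.2
        else if p.1 3 = 4 then (![-E, 0, E, 0] : Fin 4 → ℂ) p.2.2 else 0) else 0) : ψ ≠ 0 := by
  subst hψ
  intro h
  have h1 := congrFun h ((fun μ => if μ = 3 then 3 else 0 : TorusSite 4 7), 0, 0)
  simp at h1

/-- **Dark operator**: `det (γ₅ D_W(R; -1, 1) − E) = 0` for `E = ±1` and every trivial-slab field `R`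
on the torus of side `7`. [folklore] -/
theorem det_hz_eq_zero_of_slabTrivial (R : GaugeConfig 4 7 (Matrix.specialUnitaryGroup (Fin 3) ℂ))
    (hT : ∀ (v : TorusSite 4 7) (μ : Fin 4), μ ≠ 3 → (v 3 = 3 ∨ v 3 = 4) → R (v, μ) = 1)
    (hF : ∀ v : TorusSite 4 7, v 3 = 3 → R (v, 3) = 1) (E : ℂ) (hE : E = 1 ∨ E = -1) :
    (hz R (-1) E).det = 0 :=
  Matrix.exists_mulVec_eq_zero_iff.mp ⟨_, slab_ne_zero E _ rfl, hz_mulVec_slab R hT hF E hE _ rfl⟩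

/-! ## The fibre of `Q₂(0)` over a trivial-slab background is dark -/

/-- The slab layers lie outside the cube `Q₂(0)`. [folklore] -/
theorem inCube_zero_eq_false (v : TorusSite 4 7) (hv : v 3 = 3 ∨ v 3 = 4) :
    inCube (0 : TorusSite 4 7) v = false := by
  rw [inCube, decide_eq_false_iff_not, not_forall]
  refine ⟨3, ?_⟩
  rcases hv with h | h <;> simp only [h, Pi.zero_apply, zero_add] <;> decide

/-- Links with both endpoints in the slab layers are untouched by the fibre of `Q₂(0) ∪ Q₂(0)`.
[folklore] -/
theorem touches_zero_eq_false (v : TorusSite 4 7) (μ : Fin 4)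
    (h : (μ ≠ 3 ∧ (v 3 = 3 ∨ v 3 = 4)) ∨ (μ = 3 ∧ v 3 = 3)) :
    touches (0 : TorusSite 4 7) 0 (v, μ) = false := by
  have h1 : inCube (0 : TorusSite 4 7) v = false := by
    rcases h with ⟨-, hv⟩ | ⟨-, hv⟩
    · exact inCube_zero_eq_false v hv
    · exact inCube_zero_eq_false v (Or.inl hv)
  have h2 : inCube (0 : TorusSite 4 7) (Literature.MathematicalPhysics.QuantumFieldTheory.Site.shift v μ) = false := by
    apply inCube_zero_eq_false
    rw [shift_apply]
    rcases h with ⟨hμ, hv⟩ | ⟨hμ, hv⟩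
    · rw [if_neg (fun h : (3 : Fin 4) = μ => hμ h.symm), add_zero]; exact hv
    · rw [if_pos hμ.symm, hv]; right; decide
  simp only [touches, h1, h2, Bool.or_self]

/-- **Realised dark fibre of the `Q₂` pencil (MAIN).**  Torus of side `7`, `m₀ = -1`, `z = E = ±1`,
centre `x = y = 0`: for every background `U` whose links inside the slab `{v₃ ∈ {3,4}}` are trivial and
EVERY configuration `W` of the links touching `Q₂(0)`, `det (hz (refit (touches 0 0) U W) (-1) E) = 0`.
[folklore] -/
theorem det_hz_refit_eq_zero (U W : GaugeConfig 4 7 (Matrix.specialUnitaryGroup (Fin 3) ℂ))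
    (hT : ∀ (v : TorusSite 4 7) (μ : Fin 4), μ ≠ 3 → (v 3 = 3 ∨ v 3 = 4) → U (v, μ) = 1)
    (hF : ∀ v : TorusSite 4 7, v 3 = 3 → U (v, 3) = 1) (E : ℂ) (hE : E = 1 ∨ E = -1) :
    (hz (refit (touches (0 : TorusSite 4 7) 0) U W) (-1) E).det = 0 := by
  refine det_hz_eq_zero_of_slabTrivial _ (fun v μ hμ hv => ?_) (fun v hv => ?_) E hE
  · simp only [refit, touches_zero_eq_false v μ (Or.inl ⟨hμ, hv⟩)]
    exact hT v μ hμ hv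
  · simp only [refit, touches_zero_eq_false v 3 (Or.inr ⟨rfl, hv⟩)]
    exact hF v hv

/-- **The right-hand side of (MS) vanishes on a realisable fibre inside the window**:
`E_W |det (H(refit W) − z)|² = 0` at `(L, m₀, z, x, y, U) = (7, -1, ±1, 0, 0, 1)`; (MS) there demands
`adj_{00} ≡ 0` on the fibre (which holds, the corank being `≥ 6`), so the stub's "exterior flat band"
edge case is not vacuous. [folklore] -/
theorem ms_rhs_eq_zero (E : ℂ) (hE : E = 1 ∨ E = -1) :
    ∫ W, ‖(hz (refit (touches (0 : TorusSite 4 7) 0) (fun _ => 1) W) (-1) E).det‖ ^ 2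
      ∂(haarPi 7) = 0 := by
  have h : ∀ W : GaugeConfig 4 7 (Matrix.specialUnitaryGroup (Fin 3) ℂ),
      (hz (refit (touches (0 : TorusSite 4 7) 0) (fun _ => 1) W) (-1) E).det = 0 := fun W =>
    det_hz_refit_eq_zero (fun _ => 1) W (fun _ _ _ _ => rfl) (fun _ _ => rfl) E hE
  simp only [h, norm_zero, ne_eq, OfNat.ofNat_ne_zero, not_false_eq_true, zero_pow, integral_zero]

end Slab

end Summit.QuantumFields.QCD.Theorems.FrameAPrioriBound.Negative

end
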